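import Literature.Analysis.FluidPDE.PassiveScalarEnergySlice
import Literature.Analysis.FunctionSpaces.TorusScalarTrigPoly
import HarnessLib

/-!
# The spectral `A`-weighted gradient norm of a real scalar on `T^d`
# (`‖∇θ‖²_a = ∑ᵢ aᵢ ‖∂ᵢθ‖²_{L²} = 4π² ∑ₖ (∑ᵢ aᵢ kᵢ²) |θ̂(k)|²`)

Analysis/FluidPDE support file (all results proved; two definitions). For a constant diagonal
diffusion `κ ∑ᵢ aᵢ ∂ᵢ∂ᵢ` (the operator of `Torus.IsWeakScalarTransportDiagOn` /
`Torus.IsWeakScalarTransportDiagForcedOn`: the isotropic `κΔ` of a rectangular flat torus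
`ℝ^d/⊕ᵢ Lᵢℤ` written on the unit torus, `aᵢ = Lᵢ⁻²`; Hess-Childs–Rowan 2025: `a = (½, 1)`) the
quantity dissipated by the energy balance is the `A`-weighted Dirichlet form
`‖∇θ‖²_a = ∑ᵢ aᵢ ∫ (∂ᵢθ)²`, i.e. on the Fourier side `4π² ∑ₖ Q_a(k) |θ̂(k)|²` with the symbol
`Q_a(k) = ∑ᵢ aᵢ kᵢ²` of `-(4π²)⁻¹ ∑ᵢ aᵢ ∂ᵢ∂ᵢ` (Grafakos 2014, Prop. 3.1.2 (10): `∂ⱼ ↦ 2πi kⱼ`;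
Prop. 3.2.7 (3): Parseval). This file names it, in the `ℝ≥0∞`-valued spectral form of the tree's
isotropic `Torus.eScalarGradNormSq` (DEIJ 2022, (1.2)), and records the dictionary:

* `Torus.diagSymbol a k = ∑ᵢ aᵢ kᵢ²`; `Torus.eScalarGradNormSqDiag a θ = 4π² ∑ₖ Q_a(k) ‖𝓕(↑θ)(k)‖ₑ²`;
* `a ≡ 1` is the isotropic norm (`eScalarGradNormSqDiag_one`), scaling in `a`
  (`eScalarGradNormSqDiag_smul`), and the two-sided comparison
  `m ‖∇θ‖² ≤ ‖∇θ‖²_a ≤ M ‖∇θ‖²` for `m ≤ aᵢ ≤ M` (`mul_eScalarGradNormSq_le_diag`,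
  `eScalarGradNormSqDiag_le_mul`) — so `L²_t H¹_x`-type statements are the same for every
  positive `a`, only constants change;
* partial sums over the frequency balls `Torus.freqBall N` increase to the norm
  (`tendsto_sum_freqBall_diag`, `sum_freqBall_diag_le`), the form in which the Fourier–Galerkin
  energy argument produces it;
* for smooth `A` the spectral norm is the classical one, `‖∇A‖²_a = ofReal (∑ᵢ aᵢ ∫ (∂ᵢA)²)`
  (`eScalarGradNormSqDiag_eq_ofReal_sum_integral`; Parseval for `∂ᵢA`).

## Mathlib / tree search

Tree: `Torus.eScalarGradNormSq` / `eScalarGradNormSq_eq_tsum` / `tsum_sq_mul_enorm_sq_mFourierCoeff_ofReal`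
(`PassiveScalar`, `PassiveScalarEnergySlice`), `Torus.freqNormSq`, `Torus.freqBall`,
`Torus.tendsto_freqBall_atTop` (`TorusSobolevNorm`, `TorusTrigPoly`); `lean search 'GradNormSqDiag|diagSymbol'`:
nothing. Mathlib has no Sobolev norms on `UnitAddTorus`.

## References

* L. Grafakos, *Classical Fourier Analysis*, 3rd ed., GTM 249 (2014), Prop. 3.1.2 (10),
  Prop. 3.2.7 (3). [`Grafakos2014`]
* T. D. Drivas, T. M. Elgindi, G. Iyer, I.-J. Jeong, ARMA 243 (2022), (1.2). [`DEIJ2022`]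
* E. Hess-Childs, K. Rowan, arXiv:2501.18526 (2025), Def. 2.2 and App. A (the torus
  `[0,√2]×[0,1]`, non-isotropic diffusions). [`HessChildsRowan2025a`]
-/

noncomputable section

open MeasureTheory Set Filter Topology UnitAddTorus
open scoped ENNReal NNReal

namespace Literature.Analysis.FluidPDE

namespace Torus

variable {d : Type*} [Fintype d]

/-! ## The symbol `Q_a(k) = ∑ᵢ aᵢ kᵢ²` -/

/-- The symbol `Q_a(k) = ∑ᵢ aᵢ kᵢ²` of the constant diagonal operator `-(4π²)⁻¹ ∑ᵢ aᵢ ∂ᵢ∂ᵢ` on the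
unit torus (`∂ⱼ e_k = 2πi kⱼ e_k`, Grafakos 2014, Prop. 3.1.2 (10)); `Q_1 = |k|²`
(`Torus.freqNormSq`). [cite: Grafakos2014, Prop. 3.1.2 (10)] -/
def diagSymbol (a : d → ℝ) (k : d → ℤ) : ℝ :=
  ∑ i, a i * (k i : ℝ) ^ 2

/-- `Q_1(k) = |k|²`. [cite: Grafakos2014, Prop. 3.1.2 (10)] -/
theorem diagSymbol_one (k : d → ℤ) : diagSymbol (fun _ : d => (1 : ℝ)) k = FunctionSpaces.Torus.freqNormSq k := by
  simp [diagSymbol, FunctionSpaces.Torus.freqNormSq]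

/-- `Q_a(k) ≥ 0` for nonnegative coefficients. [cite: Grafakos2014, Prop. 3.1.2 (10)] -/
theorem diagSymbol_nonneg {a : d → ℝ} (ha : ∀ i, 0 ≤ a i) (k : d → ℤ) : 0 ≤ diagSymbol a k :=
  Finset.sum_nonneg fun i _ => mul_nonneg (ha i) (sq_nonneg _)

/-- `Q_a` is even: `Q_a(-k) = Q_a(k)`. [cite: Grafakos2014, Prop. 3.1.2 (10)] -/
theorem diagSymbol_neg (a : d → ℝ) (k : d → ℤ) : diagSymbol a (-k) = diagSymbol a k := by
  simp [diagSymbol]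

/-- `Q_a(0) = 0`. [cite: Grafakos2014, Prop. 3.1.2 (10)] -/
theorem diagSymbol_zero (a : d → ℝ) : diagSymbol a (0 : d → ℤ) = 0 := by
  simp [diagSymbol]

/-- Scaling: `Q_{c a}(k) = c Q_a(k)`. [cite: Grafakos2014, Prop. 3.1.2 (10)] -/
theorem diagSymbol_smul (c : ℝ) (a : d → ℝ) (k : d → ℤ) : diagSymbol (c • a) k = c * diagSymbol a k := by
  simp only [diagSymbol, Pi.smul_apply, smul_eq_mul, Finset.mul_sum]
  exact Finset.sum_congr rfl fun i _ => by ring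

/-- Lower comparison with the isotropic symbol: `m |k|² ≤ Q_a(k)` if `m ≤ aᵢ` for all `i`. [cite: HessChildsRowan2025a, App. A (non-isotropic diffusions, modified constants)] -/
theorem mul_freqNormSq_le_diagSymbol {a : d → ℝ} {m : ℝ} (hm : ∀ i, m ≤ a i) (k : d → ℤ) :
    m * FunctionSpaces.Torus.freqNormSq k ≤ diagSymbol a k := by
  simp only [diagSymbol, FunctionSpaces.Torus.freqNormSq, Finset.mul_sum]
  exact Finset.sum_le_sum fun i _ => mul_le_mul_of_nonneg_right (hm i) (sq_nonneg _)

/-- Upper comparison with the isotropic symbol: `Q_a(k) ≤ M |k|²` if `aᵢ ≤ M` for all `i`. [cite: HessChildsRowan2025a, App. A (non-isotropic diffusions, modified constants)] -/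
theorem diagSymbol_le_mul_freqNormSq {a : d → ℝ} {M : ℝ} (hM : ∀ i, a i ≤ M) (k : d → ℤ) :
    diagSymbol a k ≤ M * FunctionSpaces.Torus.freqNormSq k := by
  simp only [diagSymbol, FunctionSpaces.Torus.freqNormSq, Finset.mul_sum]
  exact Finset.sum_le_sum fun i _ => mul_le_mul_of_nonneg_right (hM i) (sq_nonneg _)

/-! ## The `A`-weighted spectral gradient norm -/

/-- The **`A`-weighted spectral squared gradient norm**
`‖∇θ‖²_a = 4π² ∑ₖ Q_a(k) ‖𝓕(↑θ)(k)‖ₑ² ∈ [0, ∞]` of a real scalar on `T^d`, `Q_a(k) = ∑ᵢ aᵢ kᵢ²`: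
the Dirichlet form `∑ᵢ aᵢ ‖∂ᵢθ‖²_{L²}` of the diagonal diffusion `∑ᵢ aᵢ ∂ᵢ∂ᵢ`
(`eScalarGradNormSqDiag_eq_ofReal_sum_integral` for smooth `θ`), the quantity dissipated by weak
solutions of `∂ₜθ + u·∇θ = κ ∑ᵢ aᵢ ∂ᵢ∂ᵢθ` (the isotropic `κ‖∇θ‖²` of DEIJ 2022, (1.2), on a
rectangular flat torus in unit-torus coordinates). For `a ≡ 1` it is `Torus.eScalarGradNormSq`
(`eScalarGradNormSqDiag_one`). Junk: as for `eScalarGradNormSq` (C4), all coefficients of a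
non-integrable `θ` vanish, so the value is `0`; negative symbols are clipped to `0` by
`ENNReal.ofReal` (meaningful for `aᵢ ≥ 0`). [cite: DEIJ2022, (1.2)] -/
def eScalarGradNormSqDiag (a : d → ℝ) (θ : UnitAddTorus d → ℝ) : ℝ≥0∞ :=
  ENNReal.ofReal (4 * Real.pi ^ 2) *
    ∑' k : d → ℤ, ENNReal.ofReal (diagSymbol a k) * ‖mFourierCoeff (fun x => (θ x : ℂ)) k‖ₑ ^ 2

variable {a : d → ℝ} {θ : UnitAddTorus d → ℝ}

/-- **`a ≡ 1` is the isotropic spectral gradient norm** `Torus.eScalarGradNormSq`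
(`eScalarGradNormSq_eq_tsum`). [cite: DEIJ2022, (1.2)] -/
theorem eScalarGradNormSqDiag_one (θ : UnitAddTorus d → ℝ) :
    eScalarGradNormSqDiag (fun _ : d => (1 : ℝ)) θ = eScalarGradNormSq θ := by
  rw [eScalarGradNormSqDiag, eScalarGradNormSq_eq_tsum]
  simp_rw [diagSymbol_one]

/-- Scaling in the coefficients: `‖∇θ‖²_{c a} = c ‖∇θ‖²_a` for `c ≥ 0`. [cite: HessChildsRowan2025a, App. A (non-isotropic diffusions, modified constants)] -/
theorem eScalarGradNormSqDiag_smul {c : ℝ} (hc : 0 ≤ c) (a : d → ℝ) (θ : UnitAddTorus d → ℝ) :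
    eScalarGradNormSqDiag (c • a) θ = ENNReal.ofReal c * eScalarGradNormSqDiag a θ := by
  rw [eScalarGradNormSqDiag, eScalarGradNormSqDiag, mul_left_comm,
    ← ENNReal.tsum_mul_left (a := ENNReal.ofReal c)]
  congr 1
  refine tsum_congr fun k => ?_
  rw [diagSymbol_smul, ENNReal.ofReal_mul hc, mul_assoc]

/-- **Lower comparison**: `m ‖∇θ‖² ≤ ‖∇θ‖²_a` whenever `0 ≤ m ≤ aᵢ` for all `i`. [cite: HessChildsRowan2025a, App. A (non-isotropic diffusions, modified constants)] -/
theorem mul_eScalarGradNormSq_le_diag {m : ℝ} (hm : 0 ≤ m) (hma : ∀ i, m ≤ a i)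
    (θ : UnitAddTorus d → ℝ) : ENNReal.ofReal m * eScalarGradNormSq θ ≤ eScalarGradNormSqDiag a θ := by
  rw [eScalarGradNormSq_eq_tsum, eScalarGradNormSqDiag, mul_left_comm,
    ← ENNReal.tsum_mul_left (a := ENNReal.ofReal m)]
  refine mul_le_mul_right (ENNReal.tsum_le_tsum fun k => ?_) _
  rw [← mul_assoc, ← ENNReal.ofReal_mul hm]
  exact mul_le_mul_left (ENNReal.ofReal_le_ofReal (mul_freqNormSq_le_diagSymbol hma k)) _

/-- **Upper comparison**: `‖∇θ‖²_a ≤ M ‖∇θ‖²` whenever `aᵢ ≤ M` for all `i` and `0 ≤ M`. [cite: HessChildsRowan2025a, App. A (non-isotropic diffusions, modified constants)] -/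
theorem eScalarGradNormSqDiag_le_mul {M : ℝ} (hM0 : 0 ≤ M) (hM : ∀ i, a i ≤ M)
    (θ : UnitAddTorus d → ℝ) : eScalarGradNormSqDiag a θ ≤ ENNReal.ofReal M * eScalarGradNormSq θ := by
  rw [eScalarGradNormSq_eq_tsum, eScalarGradNormSqDiag, mul_left_comm,
    ← ENNReal.tsum_mul_left (a := ENNReal.ofReal M)]
  refine mul_le_mul_right (ENNReal.tsum_le_tsum fun k => ?_) _
  rw [← mul_assoc, ← ENNReal.ofReal_mul hM0]
  exact mul_le_mul_left (ENNReal.ofReal_le_ofReal (diagSymbol_le_mul_freqNormSq hM k)) _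

/-- Positive coefficients on a finite index type are pinched between two positive constants:
`0 < m ≤ aᵢ ≤ M` (with `m = M = 1` allowed when `d` is empty). [folklore] -/
private theorem exists_pos_le_le_of_forall_pos (ha : ∀ i, 0 < a i) :
    ∃ m M : ℝ, 0 < m ∧ m ≤ M ∧ ∀ i, m ≤ a i ∧ a i ≤ M := by
  classical
  rcases isEmpty_or_nonempty d with hd | hd
  · exact ⟨1, 1, one_pos, le_rfl, fun i => (IsEmpty.false i).elim⟩
  · obtain ⟨i₀, -, hi₀⟩ := Finset.exists_min_image Finset.univ a Finset.univ_nonempty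
    obtain ⟨i₁, -, hi₁⟩ := Finset.exists_max_image Finset.univ a Finset.univ_nonempty
    exact ⟨a i₀, a i₁, ha i₀, hi₁ i₀ (Finset.mem_univ _),
      fun i => ⟨hi₀ i (Finset.mem_univ _), hi₁ i (Finset.mem_univ _)⟩⟩

/-- **The norm is finite iff the isotropic one is**, for positive coefficients. [cite: HessChildsRowan2025a, App. A (non-isotropic diffusions, modified constants)] -/
theorem eScalarGradNormSqDiag_lt_top_iff (ha : ∀ i, 0 < a i) (θ : UnitAddTorus d → ℝ) :
    eScalarGradNormSqDiag a θ < ∞ ↔ eScalarGradNormSq θ < ∞ := by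
  obtain ⟨m, M, hm, hmM, hb⟩ := exists_pos_le_le_of_forall_pos ha
  constructor
  · intro h
    have h1 := (mul_eScalarGradNormSq_le_diag hm.le (fun i => (hb i).1) θ).trans_lt h
    have hm0 : ENNReal.ofReal m ≠ 0 := by rwa [Ne, ENNReal.ofReal_eq_zero, not_le]
    by_contra htop
    rw [not_lt, top_le_iff] at htop
    rw [htop, ENNReal.mul_top hm0] at h1
    exact lt_irrefl _ h1
  · intro h
    exact (eScalarGradNormSqDiag_le_mul (hm.le.trans hmM) (fun i => (hb i).2) θ).trans_lt
      (ENNReal.mul_lt_top ENNReal.ofReal_lt_top h)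

/-! ## Partial sums over the frequency balls -/

/-- The summand family of `‖∇θ‖²_a`. [cite: Grafakos2014, Prop. 3.2.7 (3)] -/
theorem hasSum_eScalarGradNormSqDiag (a : d → ℝ) (θ : UnitAddTorus d → ℝ) :
    HasSum (fun k : d → ℤ => ENNReal.ofReal (4 * Real.pi ^ 2) *
      (ENNReal.ofReal (diagSymbol a k) * ‖mFourierCoeff (fun x => (θ x : ℂ)) k‖ₑ ^ 2))
      (eScalarGradNormSqDiag a θ) := by
  rw [eScalarGradNormSqDiag, ← ENNReal.tsum_mul_left]
  exact ENNReal.summable.hasSum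

variable [DecidableEq d]

/-- **The ball partial sums converge to the norm**:
`4π² ∑_{|k|≤N} Q_a(k) ‖θ̂(k)‖ₑ² → ‖∇θ‖²_a` as `N → ∞` (the balls exhaust `ℤ^d`,
`Torus.tendsto_freqBall_atTop`). [cite: Grafakos2014, §3.1.1 (square partial sums), Prop. 3.2.7 (3)] -/
theorem tendsto_sum_freqBall_diag (a : d → ℝ) (θ : UnitAddTorus d → ℝ) :
    Tendsto (fun N : ℕ => ∑ k ∈ FunctionSpaces.Torus.freqBall N, ENNReal.ofReal (4 * Real.pi ^ 2) *
      (ENNReal.ofReal (diagSymbol a k) * ‖mFourierCoeff (fun x => (θ x : ℂ)) k‖ₑ ^ 2))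
      atTop (𝓝 (eScalarGradNormSqDiag a θ)) :=
  (hasSum_eScalarGradNormSqDiag a θ).comp FunctionSpaces.Torus.tendsto_freqBall_atTop

/-- Each ball partial sum is below the norm. [cite: Grafakos2014, Prop. 3.2.7 (3)] -/
theorem sum_freqBall_diag_le (a : d → ℝ) (θ : UnitAddTorus d → ℝ) (N : ℕ) :
    ∑ k ∈ FunctionSpaces.Torus.freqBall N, ENNReal.ofReal (4 * Real.pi ^ 2) *
      (ENNReal.ofReal (diagSymbol a k) * ‖mFourierCoeff (fun x => (θ x : ℂ)) k‖ₑ ^ 2) ≤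
      eScalarGradNormSqDiag a θ := by
  rw [eScalarGradNormSqDiag, ← ENNReal.tsum_mul_left]
  exact ENNReal.sum_le_tsum _

/-- The ball partial sums increase with `N`. [cite: Grafakos2014, §3.1.1 (square partial sums)] -/
theorem monotone_sum_freqBall_diag (a : d → ℝ) (θ : UnitAddTorus d → ℝ) :
    Monotone fun N : ℕ => ∑ k ∈ FunctionSpaces.Torus.freqBall N, ENNReal.ofReal (4 * Real.pi ^ 2) *
      (ENNReal.ofReal (diagSymbol a k) * ‖mFourierCoeff (fun x => (θ x : ℂ)) k‖ₑ ^ 2) :=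
  fun _ _ h => Finset.sum_le_sum_of_subset (FunctionSpaces.Torus.freqBall_mono h)

/-- The norm is the supremum of the ball partial sums. [cite: Grafakos2014, §3.1.1 (square partial sums), Prop. 3.2.7 (3)] -/
theorem iSup_sum_freqBall_diag (a : d → ℝ) (θ : UnitAddTorus d → ℝ) :
    ⨆ N : ℕ, ∑ k ∈ FunctionSpaces.Torus.freqBall N, ENNReal.ofReal (4 * Real.pi ^ 2) *
      (ENNReal.ofReal (diagSymbol a k) * ‖mFourierCoeff (fun x => (θ x : ℂ)) k‖ₑ ^ 2) =
      eScalarGradNormSqDiag a θ :=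
  tendsto_nhds_unique (tendsto_atTop_iSup (monotone_sum_freqBall_diag a θ))
    (tendsto_sum_freqBall_diag a θ)

/-- **Real form of the ball partial sums** (nonnegative coefficients): the `ℝ≥0∞` partial sum is
`ofReal` of the real one `4π² ∑_{|k|≤N} Q_a(k) |θ̂(k)|²`. [cite: Grafakos2014, Prop. 3.2.7 (3)] -/
theorem sum_freqBall_diag_eq_ofReal (ha : ∀ i, 0 ≤ a i) (θ : UnitAddTorus d → ℝ) (N : ℕ) :
    ∑ k ∈ FunctionSpaces.Torus.freqBall N, ENNReal.ofReal (4 * Real.pi ^ 2) *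
      (ENNReal.ofReal (diagSymbol a k) * ‖mFourierCoeff (fun x => (θ x : ℂ)) k‖ₑ ^ 2) =
      ENNReal.ofReal (4 * Real.pi ^ 2 * ∑ k ∈ FunctionSpaces.Torus.freqBall N,
        diagSymbol a k * ‖mFourierCoeff (fun x => (θ x : ℂ)) k‖ ^ 2) := by
  rw [ENNReal.ofReal_mul (p := 4 * Real.pi ^ 2) (by positivity), ENNReal.ofReal_sum_of_nonneg
    (fun k _ => mul_nonneg (diagSymbol_nonneg ha k) (sq_nonneg _)), Finset.mul_sum]
  refine Finset.sum_congr rfl fun k _ => ?_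
  rw [ENNReal.ofReal_mul (diagSymbol_nonneg ha k), ← ofReal_norm, ← ENNReal.ofReal_pow (norm_nonneg _)]

/-! ## Smooth scalars: the classical `A`-weighted Dirichlet form -/

omit [DecidableEq d] in
/-- **For smooth `A` the spectral `A`-norm is the classical one**:
`‖∇A‖²_a = ofReal (∑ᵢ aᵢ ∫ (∂ᵢA)²)` for `aᵢ ≥ 0` (Parseval for `∂ᵢA`,
`Literature.Analysis.FluidPDE.tsum_sq_mul_enorm_sq_mFourierCoeff_ofReal`; Grafakos 2014,
Prop. 3.2.6 (8), 3.2.7 (3)). [cite: Grafakos2014, Prop. 3.2.7 (3)] -/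
theorem eScalarGradNormSqDiag_eq_ofReal_sum_integral [DecidableEq d] (ha : ∀ i, 0 ≤ a i)
    {A : UnitAddTorus d → ℝ} (hA : FunctionSpaces.Torus.IsSmooth A) :
    eScalarGradNormSqDiag a A =
      ENNReal.ofReal (∑ i, a i * ∫ x, (FunctionSpaces.Torus.partialDeriv i A x) ^ 2) := by
  have hsplit : ∀ k : d → ℤ, ENNReal.ofReal (diagSymbol a k) * ‖mFourierCoeff (fun x => (A x : ℂ)) k‖ₑ ^ 2 =
      ∑ i, ENNReal.ofReal (a i) * (ENNReal.ofReal ((k i : ℝ) ^ 2) * ‖mFourierCoeff (fun x => (A x : ℂ)) k‖ₑ ^ 2) := by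
    intro k
    rw [diagSymbol, ENNReal.ofReal_sum_of_nonneg (fun i _ => mul_nonneg (ha i) (sq_nonneg _)),
      Finset.sum_mul]
    refine Finset.sum_congr rfl fun i _ => ?_
    rw [ENNReal.ofReal_mul (ha i), mul_assoc]
  rw [eScalarGradNormSqDiag]
  simp_rw [hsplit]
  rw [Summable.tsum_finsetSum (fun i _ => ENNReal.summable)]
  simp_rw [ENNReal.tsum_mul_left, tsum_sq_mul_enorm_sq_mFourierCoeff_ofReal hA]
  rw [ENNReal.ofReal_sum_of_nonneg (fun i _ => mul_nonneg (ha i) (integral_nonneg fun x => sq_nonneg _)),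
    Finset.mul_sum]
  refine Finset.sum_congr rfl fun i _ => ?_
  rw [← ENNReal.ofReal_mul (ha i), ← ENNReal.ofReal_mul (by positivity)]
  congr 1
  have h4 : (4 * Real.pi ^ 2) * ((4 * Real.pi ^ 2)⁻¹ * ∫ x, (FunctionSpaces.Torus.partialDeriv i A x) ^ 2) =
      ∫ x, (FunctionSpaces.Torus.partialDeriv i A x) ^ 2 := by
    rw [← mul_assoc, mul_inv_cancel₀ (by positivity), one_mul]
  rw [mul_left_comm, h4]

end Torus

end Literature.Analysis.FluidPDE

end
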